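/-
Copyright (c) 2026 the pub-hodgecm-mathlib formalisation cell (harness21).  Prover seat hodgecm-mathlib-LH4-p08 (g11) (valve hand), Track B «K2-LIT»,
#184♮ = hLiu418 = `stmt-HodgeConjecture-24832`; socket #41, KIND W — the EXPLICIT edition of the per-place Whittaker letters (growth twin census, KW desk
F0P2-p08 (g3) 01:00:37Z (KW-arch-hBL) (b)).  THEOREMS ONLY (no `def`, no `instance`, no notation, no named-fact hypothesis, no `sorry`).
-/
import Summits.HodgeConjecture.HodgeConjecture.Theorems.K2LiuKindWArchWhittakerLetterNegDef   -- ★ p863756 (mirror letters) ⊇ ★ p863627 (Pic engine) ⊇ ★ p863390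
import HarnessLib

/-!
# Crux `HLiu418`, socket #41, KIND W — `K2LiuKindWArchWhittakerLetterExplicit`: THE PER-PLACE ARCHIMEDEAN WHITTAKER LETTER WITH ITS CONTINUATION
# WRITTEN OUT (Iwasawa letters, K-picture polynomial, ★ JUNCTION's function WITH its growth clause)

Cell `hodgecm-mathlib`, crux item hLiu418 = `stmt-HodgeConjecture-24832` (helper lane `--supports … --as helper`, count-neutral), route of record `HCCMUnconditional`;
squad K2 ∕ K2Liu, road `K2_Liu`, socket #41, KIND W.  ★ p863627 `exists_twistedWhittaker_continuation_of_posDef_pic` (and its instances ★ p863390 (2,0), ★ p863756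
(0,2)) export the continuation `Ew` of the twisted unipotent integral as a bare existential with holomorphy on `{0 < re}` — ★ JUNCTION's GROWTH clause (ii) is
dropped on the way.  The (iii-arch) block letter `hBL` (★ `K2LiuKindWBlockOfRecordCMOfLocalLettersHaar` :170–185) needs the growth.  THIS FILE re-runs the same proof
and EXPORTS EVERYTHING: the arch Iwasawa letters `(X₀, R, u₀)` of `diag(C, −B)·g` (★ `exists_transl_levi_mul_stabilizer`), the K-picture polynomial `P` of the
`u₀`-translates (the bridge `hKpic` at `u₀`) WITH its defining property, ★ JUNCTION's function `FJ` WITH clauses (i) holomorphy AND (ii) growth (uniform in the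
positive definite index, locally uniform in `s`; constants depend on `P`), and the EXPLICIT continuation
`Ew s = 8⁻¹ · ‖det C‖⁻⁴ · e(tr(h₁X₀)) · χ_k(det R⁻¹) · ‖det R‖^{2−2s} · FJ h₂ s`, `h₁ = C⁻ᴴ·hidx·C⁻¹`, `h₂ = Rᴴ h₁ R`:
* §1 **`exists_twistedWhittaker_explicit_of_posDef_pic`** (generic picture predicate, positive definite index);
* §2 **`exists_twistedWhittaker_explicit_of_posDef`** ∕ **`…_of_negDef`** (the `evalAt … Q` picture; (0,2) by the block-sign mirror of ★ p863756, letters for the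
  mirrored frame `(θx, D g D, −hidx)`).
What is NOT here (honest): UNIFORMITY of JUNCTION's constants over the K-picture family `{P(u₀) : u₀ ∈ Stab(iI)}` (needs a (V-4)∕JUNCTION edition exporting the
dependence of the constants on the coefficients of `P`) and the (1,1) organ «Φ6b-ind».
[Shimura1997, §16.4, §18.4] [KudlaRallis1994, §1].
HONEST LABEL.  Count-neutral helper, closes no socket: `HC_CM` is proved only modulo the 7 printed citations (2 remaining named inputs: hLiu418 =
`stmt-HodgeConjecture-24832`, h413 = `stmt-HodgeConjecture-24833`) until rung 0 closes.
-/

set_option autoImplicit false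
set_option linter.dupNamespace false -- the mandated namespace repeats `HodgeConjecture.HodgeConjecture`

noncomputable section

open Complex Matrix MeasureTheory
open scoped ComplexConjugate ComplexOrder
open Literature.NumberTheory.ModularForms.SiegelUpperHalfSpace (moeb num denom moeb_def num_fromBlocks denom_fromBlocks)

namespace Summit.HodgeConjecture.HodgeConjecture.Cruxes.HLiu418.K2LiuKindWArchWhittakerLetterExplicit

open Summit.HodgeConjecture.HodgeConjecture.Cruxes.HLiu418.K2LiuHermTwoGammaDefs (hermTwo hermTwo_eq_of_isHermitian)
open Summit.HodgeConjecture.HodgeConjecture.Cruxes.HLiu418.K2LiuHermTwoEtaDefs (hermTwo_add)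
open Summit.HodgeConjecture.HodgeConjecture.Cruxes.HLiu418.K2LiuHermitianTubeCocycle (mul_mem_UJ J_mem)
open Summit.HodgeConjecture.HodgeConjecture.Cruxes.HLiu418.K2LiuHermitianTubeAction (exists_transl_levi_mul_stabilizer)
open Summit.HodgeConjecture.HodgeConjecture.Cruxes.HLiu418.K2LiuArchInducedTubeDefs
open Summit.HodgeConjecture.HodgeConjecture.Cruxes.HLiu418.K2LiuU22CompactPictureDefs
open Summit.HodgeConjecture.HodgeConjecture.Cruxes.HLiu418.K2LiuArchWhittakerLeviEquivariance
open Summit.HodgeConjecture.HodgeConjecture.Cruxes.HLiu418.K2LiuArchIntertwiningScalarValue (integral_hermOfReal_eq)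
open Summit.HodgeConjecture.HodgeConjecture.Cruxes.HLiu418.K2LiuArchBlockOfFrame (antidiag_letters antidiag_eq_J_mul_levi levi_mul_transl)
open Summit.HodgeConjecture.HodgeConjecture.Cruxes.HLiu418.K2LiuKFiniteSectionWhittakerHolomorphyGrowth (kFiniteSection_whittaker_holomorphy_growth)
open Summit.HodgeConjecture.HodgeConjecture.Cruxes.HLiu418.K2LiuKindWArchWhittakerLetterNegDef

/-! ## §1 The explicit letter, generic in the picture predicate -/

/-- **THE TWISTED UNIPOTENT INTEGRAL WRITTEN OUT.**  For a framed element `x = (0 B; C 0) ∈ U(J)`, `g ∈ U(J)`, a positive definite index `hidx` read as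
`eb(b) = e(−tr(hidx·b))`, and a bridge `hKpic` from the picture predicate `Pic` to ★ JUNCTION's polynomial K-pictures: there are arch Iwasawa letters
`diag(C, −B)·g = n(X₀)·diag(R, R⁻¹)·u₀` (`X₀` hermitian, `R` hermitian invertible, `u₀ ∈ Stab(iI)`), the K-picture polynomial `P` of the `u₀`-translates, and ★
JUNCTION's function `FJ` with its HOLOMORPHY and GROWTH clauses verbatim (growth uniform in the positive definite index, locally uniform in `s`), such that for
`s₀ < re s` every `F ∈ I_w(s, χ_k)` with `Pic s F` has
`∫ F(x·n(b)·g)·eb(b) db = 8⁻¹·‖det C‖⁻⁴·e(tr(h₁X₀))·χ_k(det R⁻¹)·‖det R‖^{2−2s}·FJ (Rᴴ h₁ R) s`, `h₁ = C⁻ᴴ·hidx·C⁻¹`.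
(★ p863627 = this with the letters hidden.) [cite: Shimura1997, §16.4, §18.4] [cite: KudlaRallis1994, §1] -/
theorem exists_twistedWhittaker_explicit_of_posDef_pic (k : ℤ)
    (Pic : ℂ → (Matrix (Fin 2 ⊕ Fin 2) (Fin 2 ⊕ Fin 2) ℂ → ℂ) → Prop)
    {B C : Matrix (Fin 2) (Fin 2) ℂ}
    (hx : (fromBlocks 0 B C 0 : Matrix (Fin 2 ⊕ Fin 2) (Fin 2 ⊕ Fin 2) ℂ)ᴴ * Matrix.J (Fin 2) ℂ * (fromBlocks 0 B C 0 : Matrix (Fin 2 ⊕ Fin 2) (Fin 2 ⊕ Fin 2) ℂ) =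
      Matrix.J (Fin 2) ℂ)
    {g : Matrix (Fin 2 ⊕ Fin 2) (Fin 2 ⊕ Fin 2) ℂ} (hg : gᴴ * Matrix.J (Fin 2) ℂ * g = Matrix.J (Fin 2) ℂ)
    {hidx : Matrix (Fin 2) (Fin 2) ℂ} (hpos : hidx.PosDef)
    {eb : Matrix (Fin 2) (Fin 2) ℂ → ℂ} (heb : ∀ b, eb b = cexp (-(2 * Real.pi * I) * (hidx * b).trace))
    (hKpic : ∀ k₀ : Matrix (Fin 2 ⊕ Fin 2) (Fin 2 ⊕ Fin 2) ℂ, k₀ᴴ * Matrix.J (Fin 2) ℂ * k₀ = Matrix.J (Fin 2) ℂ →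
      moeb k₀ (I • (1 : Matrix (Fin 2) (Fin 2) ℂ)) = I • 1 →
      ∃ P : MvPolynomial (((Fin 2 ⊕ Fin 2) × (Fin 2 ⊕ Fin 2)) ⊕ ((Fin 2 ⊕ Fin 2) × (Fin 2 ⊕ Fin 2))) ℂ,
        ∀ (s : ℂ) (F : Matrix (Fin 2 ⊕ Fin 2) (Fin 2 ⊕ Fin 2) ℂ → ℂ), IsArchSiegelSection (fun z : ℂ => (conj z / ((‖z‖ : ℝ) : ℂ)) ^ k) s F →
          Pic s F →
          ∀ u : Matrix (Fin 2 ⊕ Fin 2) (Fin 2 ⊕ Fin 2) ℂ, uᴴ * Matrix.J (Fin 2) ℂ * u = Matrix.J (Fin 2) ℂ → moeb u (I • (1 : Matrix (Fin 2) (Fin 2) ℂ)) = I • 1 →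
            F (u * k₀) = MvPolynomial.eval (Sum.elim (fun pq => u pq.1 pq.2) (fun pq => conj (u pq.1 pq.2))) P) :
    ∃ (X₀ R : Matrix (Fin 2) (Fin 2) ℂ) (u₀ : Matrix (Fin 2 ⊕ Fin 2) (Fin 2 ⊕ Fin 2) ℂ)
      (P : MvPolynomial (((Fin 2 ⊕ Fin 2) × (Fin 2 ⊕ Fin 2)) ⊕ ((Fin 2 ⊕ Fin 2) × (Fin 2 ⊕ Fin 2))) ℂ)
      (FJ : Matrix (Fin 2) (Fin 2) ℂ → ℂ → ℂ) (s₀ : ℝ),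
      -- the arch Iwasawa letters of `diag(C, −B) · g`
      X₀ᴴ = X₀ ∧ Rᴴ = R ∧ IsUnit R.det ∧ u₀ᴴ * Matrix.J (Fin 2) ℂ * u₀ = Matrix.J (Fin 2) ℂ ∧ moeb u₀ (I • (1 : Matrix (Fin 2) (Fin 2) ℂ)) = I • 1 ∧
      (fromBlocks C 0 0 (-B) : Matrix (Fin 2 ⊕ Fin 2) (Fin 2 ⊕ Fin 2) ℂ) * g = fromBlocks 1 X₀ 0 1 * fromBlocks R 0 0 R⁻¹ * u₀ ∧
      -- the K-picture polynomial of the `u₀`-translates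
      (∀ (s : ℂ) (F : Matrix (Fin 2 ⊕ Fin 2) (Fin 2 ⊕ Fin 2) ℂ → ℂ), IsArchSiegelSection (fun z : ℂ => (conj z / ((‖z‖ : ℝ) : ℂ)) ^ k) s F → Pic s F →
        ∀ u : Matrix (Fin 2 ⊕ Fin 2) (Fin 2 ⊕ Fin 2) ℂ, uᴴ * Matrix.J (Fin 2) ℂ * u = Matrix.J (Fin 2) ℂ → moeb u (I • (1 : Matrix (Fin 2) (Fin 2) ℂ)) = I • 1 →
          F (u * u₀) = MvPolynomial.eval (Sum.elim (fun pq => u pq.1 pq.2) (fun pq => conj (u pq.1 pq.2))) P) ∧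
      -- ★ JUNCTION (i): holomorphy of `FJ h` on every open set inside `{0 < re(s + 1 + k∕2)}`, `h ≻ 0`
      (∀ {U : Set ℂ}, IsOpen U → (∀ s ∈ U, 0 < (s + 1 + (k : ℂ) / 2).re) →
        ∀ {h : Matrix (Fin 2) (Fin 2) ℂ}, h.PosDef → DifferentiableOn ℂ (FJ h) U) ∧
      -- ★ JUNCTION (ii): growth, uniform in `h ≻ 0`, locally uniform in `s`
      (∀ {K : Set ℂ}, IsCompact K → (∀ s ∈ K, 0 < (s + 1 + (k : ℂ) / 2).re) →
        ∃ Cg N N' : ℝ, 0 ≤ Cg ∧ 0 ≤ N ∧ 0 ≤ N' ∧ ∀ h : Matrix (Fin 2) (Fin 2) ℂ, h.PosDef → ∀ s ∈ K,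
          ‖FJ h s‖ ≤ Cg * Real.exp (-(Real.pi * ((h 0 0).re + (h 1 1).re))) * (1 + ((h 0 0).re + (h 1 1).re)) ^ N *
            (1 + ((h 0 0).re * (h 1 1).re - normSq (h 0 1)) ^ (-N'))) ∧
      -- the explicit continuation at `s₀ < re s`
      ∀ s : ℂ, s₀ < s.re →
        ∀ F : Matrix (Fin 2 ⊕ Fin 2) (Fin 2 ⊕ Fin 2) ℂ → ℂ, IsArchSiegelSection (fun z : ℂ => (conj z / ((‖z‖ : ℝ) : ℂ)) ^ k) s F → Pic s F →
          ∫ r : Fin 2 → Fin 2 → ℝ, F ((fromBlocks 0 B C 0 : Matrix (Fin 2 ⊕ Fin 2) (Fin 2 ⊕ Fin 2) ℂ) * fromBlocks 1 (hermOfReal r) 0 1 * g) * eb (hermOfReal r) =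
            (1 / 8 : ℂ) * (((((‖C.det‖ : ℝ) : ℂ) ^ 4)⁻¹) * (cexp ((2 * Real.pi * I) * (((C⁻¹)ᴴ * hidx * C⁻¹) * X₀).trace) *
              ((fun z : ℂ => (conj z / ((‖z‖ : ℝ) : ℂ)) ^ k) R⁻¹.det * (((‖R.det‖ : ℝ) : ℂ) ^ (2 - 2 * s) * FJ (Rᴴ * ((C⁻¹)ᴴ * hidx * C⁻¹) * R) s)))) := by
  /- §0 frame letters -/
  obtain ⟨hCB, hBC⟩ := antidiag_letters hx
  have hC : C.det ≠ 0 := (Matrix.isUnit_det_of_left_inverse hBC).ne_zero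
  have hCu : IsUnit C.det := isUnit_iff_ne_zero.2 hC
  have hCiC : C⁻¹ * C = 1 := Matrix.nonsing_inv_mul C hCu
  have hCCi : C * C⁻¹ = 1 := Matrix.mul_nonsing_inv C hCu
  have hm₀ := levi_mem hBC                                   -- `m₀ := diag(C, −B) ∈ U(J)`
  have hg' := mul_mem_UJ hm₀ hg                              -- `g' := m₀ · g ∈ U(J)`
  /- §1 arch Iwasawa of `g'` and the K-picture of the `u₀`-translates -/
  obtain ⟨X₀, R, u₀, hX₀, hR, hRu, hu₀J, hu₀i, hg'eq⟩ := exists_transl_levi_mul_stabilizer hg'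
  obtain ⟨P, hP⟩ := hKpic u₀ hu₀J hu₀i
  have hRRi : R * R⁻¹ = 1 := Matrix.mul_nonsing_inv R hRu
  have hRiR : R⁻¹ * R = 1 := Matrix.nonsing_inv_mul R hRu
  have had : Rᴴ * R⁻¹ = 1 := by rw [hR, hRRi]
  have hRdet : R.det ≠ 0 := hRu.ne_zero
  /- §2 the two index changes and the JUNCTION at the final index -/
  set h₁ : Matrix (Fin 2) (Fin 2) ℂ := (C⁻¹)ᴴ * hidx * C⁻¹ with hh₁
  set h₂ : Matrix (Fin 2) (Fin 2) ℂ := Rᴴ * h₁ * R with hh₂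
  have hCiu : IsUnit C⁻¹ := by
    rw [Matrix.isUnit_iff_isUnit_det]; exact Matrix.isUnit_det_of_left_inverse hCCi
  have hRu' : IsUnit R := (Matrix.isUnit_iff_isUnit_det R).2 hRu
  have h₁pos : h₁.PosDef := hpos.conjTranspose_mul_mul_same (Matrix.mulVec_injective_iff_isUnit.2 hCiu)
  have h₂pos : h₂.PosDef := h₁pos.conjTranspose_mul_mul_same (Matrix.mulVec_injective_iff_isUnit.2 hRu')
  obtain ⟨FJ, s₀, hFJhol, hFJgr, hFJint⟩ := kFiniteSection_whittaker_holomorphy_growth P k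
  /- §3 the letters, exported -/
  set χ : ℂ → ℂ := fun z : ℂ => (conj z / ((‖z‖ : ℝ) : ℂ)) ^ k with hχ
  set K₀ : ℂ := cexp ((2 * Real.pi * I) * (h₁ * X₀).trace) with hK₀
  refine ⟨X₀, R, u₀, P, FJ, s₀, hX₀, hR, hRu, hu₀J, hu₀i, hg'eq, hP, hFJhol, hFJgr, fun s hs F hF hFQ => ?_⟩
  show _ = (1 / 8 : ℂ) * (((((‖C.det‖ : ℝ) : ℂ) ^ 4)⁻¹) * (K₀ * (χ R⁻¹.det * (((‖R.det‖ : ℝ) : ℂ) ^ (2 - 2 * s) * FJ h₂ s))))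
  /- §4 the identity at `s₀ < re s` (★ p863627's Steps A–D verbatim) -/
  set f : Matrix (Fin 2 ⊕ Fin 2) (Fin 2 ⊕ Fin 2) ℂ → ℂ := fun y => F (y * u₀) with hf
  have hfS : IsArchSiegelSection χ s f := isArchSiegelSection_rightTranslate hF u₀
  have hfK : ∀ u : Matrix (Fin 2 ⊕ Fin 2) (Fin 2 ⊕ Fin 2) ℂ, uᴴ * Matrix.J (Fin 2) ℂ * u = Matrix.J (Fin 2) ℂ →
      moeb u (I • (1 : Matrix (Fin 2) (Fin 2) ℂ)) = I • 1 →
      f u = MvPolynomial.eval (Sum.elim (fun pq => u pq.1 pq.2) (fun pq => conj (u pq.1 pq.2))) P :=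
    fun u hu hui => hP s F hF hFQ u hu hui
  -- the twist read at `h₁`: `eb X = e₁ (C X Cᴴ)`
  have heb₁ : ∀ X : Matrix (Fin 2) (Fin 2) ℂ, eb X = cexp (-(2 * Real.pi * I) * (h₁ * (C * X * Cᴴ)).trace) := by
    intro X
    rw [heb, trace_mul_conj h₁ C X, hh₁]
    congr 3
    rw [show Cᴴ * ((C⁻¹)ᴴ * hidx * C⁻¹) * C = (C⁻¹ * C)ᴴ * hidx * (C⁻¹ * C) by
      rw [Matrix.conjTranspose_mul]; simp only [Matrix.mul_assoc], hCiC, Matrix.conjTranspose_one, Matrix.one_mul, Matrix.mul_one]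
  -- the frame algebra: `x · n(X) · g = J · n(C X Cᴴ) · g'`
  have e1 : ∀ X : Matrix (Fin 2) (Fin 2) ℂ, (fromBlocks 0 B C 0 : Matrix (Fin 2 ⊕ Fin 2) (Fin 2 ⊕ Fin 2) ℂ) * fromBlocks 1 X 0 1 * g =
      Matrix.J (Fin 2) ℂ * fromBlocks 1 (C * X * Cᴴ) 0 1 * (fromBlocks C 0 0 (-B) * g) := by
    intro X
    rw [antidiag_eq_J_mul_levi, Matrix.mul_assoc (Matrix.J (Fin 2) ℂ), levi_mul_transl hCB, ← Matrix.mul_assoc (Matrix.J (Fin 2) ℂ),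
      Matrix.mul_assoc _ _ g]
  -- the Iwasawa rewriting: `J · n(Y) · g' = (J · n(Y + X₀) · m(R,R⁻¹)) · u₀`
  have e2 : ∀ Y : Matrix (Fin 2) (Fin 2) ℂ, Matrix.J (Fin 2) ℂ * fromBlocks 1 Y 0 1 * (fromBlocks C 0 0 (-B) * g) =
      Matrix.J (Fin 2) ℂ * fromBlocks 1 (Y + X₀) 0 1 * fromBlocks R 0 0 R⁻¹ * u₀ := by
    intro Y
    have hn : (fromBlocks 1 Y 0 1 : Matrix (Fin 2 ⊕ Fin 2) (Fin 2 ⊕ Fin 2) ℂ) * fromBlocks 1 X₀ 0 1 = fromBlocks 1 (Y + X₀) 0 1 := by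
      rw [fromBlocks_multiply]; simp [add_comm]
    rw [hg'eq, ← hn]
    simp only [Matrix.mul_assoc]
  -- the twisted integrand in the two charts
  set G : Matrix (Fin 2) (Fin 2) ℂ → ℂ := fun Y =>
    F (Matrix.J (Fin 2) ℂ * fromBlocks 1 Y 0 1 * (fromBlocks C 0 0 (-B) * g)) * cexp (-(2 * Real.pi * I) * (h₁ * Y).trace) with hG
  set c₀ : ℝ × ℂ × ℝ := ((X₀ 0 0).re, X₀ 0 1, (X₀ 1 1).re) with hc₀
  have hX₀c : hermTwo c₀ = X₀ := hermTwo_eq_of_isHermitian hX₀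
  set G₂ : ℝ × ℂ × ℝ → ℂ := fun c =>
    f (Matrix.J (Fin 2) ℂ * fromBlocks 1 (hermTwo c) 0 1 * fromBlocks R 0 0 R⁻¹) * cexp (-(2 * Real.pi * I) * (h₁ * hermTwo c).trace) * K₀ with hG₂
  -- Step A+B: chart and frame algebra, pointwise
  have hAB : ∀ X : Matrix (Fin 2) (Fin 2) ℂ,
      F ((fromBlocks 0 B C 0 : Matrix (Fin 2 ⊕ Fin 2) (Fin 2 ⊕ Fin 2) ℂ) * fromBlocks 1 X 0 1 * g) * eb X = G (C * X * Cᴴ) := by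
    intro X; rw [hG, e1, heb₁]
  -- Step D pointwise: `G (hermTwo c) = G₂ (c₀ + c)`
  have hD : ∀ c : ℝ × ℂ × ℝ, G (hermTwo c) = G₂ (c₀ + c) := by
    intro c
    have hY : hermTwo (c₀ + c) = hermTwo c + X₀ := by rw [hermTwo_add, hX₀c, add_comm]
    simp only [hG, hG₂, hf]
    rw [e2, hY, mul_assoc (F _)]
    congr 1
    rw [hK₀, ← Complex.exp_add]
    congr 1
    rw [Matrix.mul_add, Matrix.trace_add]
    ring
  -- Lebesgue measure on the chart `ℝ × ℂ × ℝ` is an additive Haar measure (as in ★ `integral_hermOfReal_eq`)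
  haveI hCvol : ((volume : Measure ℂ).prod (volume : Measure ℝ)).IsAddHaarMeasure := Measure.prod.instIsAddHaarMeasure _ _
  haveI : (volume : Measure (ℝ × ℂ × ℝ)).IsAddHaarMeasure := by
    rw [show (volume : Measure (ℝ × ℂ × ℝ)) = (volume : Measure ℝ).prod ((volume : Measure ℂ).prod (volume : Measure ℝ)) from rfl]
    exact Measure.prod.instIsAddHaarMeasure _ _
  calc ∫ r : Fin 2 → Fin 2 → ℝ, F ((fromBlocks 0 B C 0 : Matrix (Fin 2 ⊕ Fin 2) (Fin 2 ⊕ Fin 2) ℂ) * fromBlocks 1 (hermOfReal r) 0 1 * g) * eb (hermOfReal r)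
      = (1 / 8 : ℂ) * ∫ c : ℝ × ℂ × ℝ, G (C * hermTwo c * Cᴴ) := by
        rw [integral_hermOfReal_eq (fun X => F ((fromBlocks 0 B C 0 : Matrix (Fin 2 ⊕ Fin 2) (Fin 2 ⊕ Fin 2) ℂ) * fromBlocks 1 X 0 1 * g) * eb X)]
        simp only [hAB]
    _ = (1 / 8 : ℂ) * ((((‖C.det‖ : ℝ) : ℂ) ^ 4)⁻¹ * ∫ c : ℝ × ℂ × ℝ, G (hermTwo c)) := by
        congr 1
        rw [integral_comp_hermTwo_conj hC G, Complex.real_smul, ofReal_pow, ← mul_assoc,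
          inv_mul_cancel₀ (pow_ne_zero _ (ofReal_ne_zero.2 (norm_pos_iff.2 hC).ne')), one_mul]
    _ = (1 / 8 : ℂ) * ((((‖C.det‖ : ℝ) : ℂ) ^ 4)⁻¹ * ∫ c : ℝ × ℂ × ℝ, G₂ c) := by
        simp only [hD]
        rw [integral_add_left_eq_self G₂ c₀]
    _ = (1 / 8 : ℂ) * ((((‖C.det‖ : ℝ) : ℂ) ^ 4)⁻¹ * (K₀ *
          ∫ c : ℝ × ℂ × ℝ, f (Matrix.J (Fin 2) ℂ * fromBlocks 1 (hermTwo c) 0 1 * fromBlocks R 0 0 R⁻¹) *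
            cexp (-(2 * Real.pi * I) * (h₁ * hermTwo c).trace))) := by
        rw [hG₂, integral_mul_const, mul_comm _ K₀]
    _ = (1 / 8 : ℂ) * ((((‖C.det‖ : ℝ) : ℂ) ^ 4)⁻¹ * (K₀ * (χ R⁻¹.det * (((‖R.det‖ : ℝ) : ℂ) ^ (2 - 2 * s) *
          ∫ c : ℝ × ℂ × ℝ, f (Matrix.J (Fin 2) ℂ * fromBlocks 1 (hermTwo c) 0 1) * cexp (-(2 * Real.pi * I) * (h₂ * hermTwo c).trace))))) := by
        rw [whittaker_levi_equivariance hfS had h₁, hh₂, mul_assoc (χ R⁻¹.det)]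
    _ = (1 / 8 : ℂ) * ((((‖C.det‖ : ℝ) : ℂ) ^ 4)⁻¹ * (K₀ * (χ R⁻¹.det * (((‖R.det‖ : ℝ) : ℂ) ^ (2 - 2 * s) * FJ h₂ s)))) := by
        rw [hFJint h₂ h₂pos s hs f hfS hfK]

end Summit.HodgeConjecture.HodgeConjecture.Cruxes.HLiu418.K2LiuKindWArchWhittakerLetterExplicit

end
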